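import Summits.BirchSwinnertonDyer.Rank1Residual.X11b.PadicInertiaCharacter
import HarnessLib

/-!
# X11b, S29 K3 piece (T2), limit form: `ℤ_p`-VALUED CHARACTERS OF `Γ_{ℚ_p}` ON INERTIA

HONEST FRAMING (cell `b2b-bsdres`, run/shared/lean/b2b/bsd-rank1-residual/, verbatim in every
file): the goal of the cell is to DELETE the COMBINATION-SHAPED residual classes of the
Birch–Swinnerton-Dyer formula for ALL analytic-rank `≤ 1` elliptic curves over `ℚ` — assembled
STRICTLY from published theorems — so that the rank-`≤ 1` remainder becomes exactly the
CONSTRUCTION-SHAPED classes, which are TYPED, NOT attempted. This is not "finishing BSD". Team N8/O2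
(X11b at `3`: `3 ‖ N`, `r_an = 1`, `E[3]` irreducible); deal S29 (x11b3-lead GEN 8, OWNERS R9-8 /
R9-25 / R9-27), package K3, piece (T2), seat `b2b-bsdres-x11b3-p5` (gen. 6); consumer shape
(T2-ii) fixed by `b2b-bsdres-x11b3-p1` (gen. 3), INBOX l.4871. WORDING OF RECORD (H45, R9-8): S29
RE-EXPRESSES (t) ⟸ (VR); this file is an UNCONDITIONAL kernel lemma (local class field theory of
`ℚ_p`) and SUPPLIES NOTHING of the class record by itself; the node `Three.HsiehDescentAt₃` is
UNCHANGED; O2 OPEN / N8 CONSTRUCTION; nothing booked. THEOREMS ONLY (no definition, no named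
fact, no `sorry`); valid at EVERY prime `p`.

## What this file proves

With the notation of `X11b/PadicInertiaCharacter.lean` (`I = absInertia ℚ_[p]`,
`χ_p = GaloisRep.cyclotomicCharacter ℚ_[p] p`, the tree's Prop-valued local-field structure on
Mathlib's `ℚ_[p]` as an instance binder):

* `toZModPow_apply_eq_of_toZModPow_cyclotomicCharacter_eq` — for a continuous additive
  `a : Γ_{ℚ_p} → ℤ_p` (`a (σ τ) = a σ + a τ`) and every `m` there is `k ≥ 1` with
  `χ_p(σ) ≡ χ_p(σ') (mod p^k) ⇒ a(σ) ≡ a(σ') (mod p^m)` for `σ, σ' ∈ I` (the finite-level inertia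
  form `exists_eq_comp_cyclotomicCharacter_of_mem_absInertia` applied to `a mod p^m`);
* `exists_continuous_factor` — hence `a|_I = f ∘ χ_p|_I` for a continuous additive
  `f : ℤ_pˣ → ℤ_p` (`f := a ∘ s`, `s` a section of `χ_p|_I` from `χ_p(I) = ℤ_pˣ`; continuity
  because `f mod p^m` is constant on cosets of `1 + p^{k_m} ℤ_p` — no compactness of `I` used);
* `apply_eq_zero_of_mem_absInertia_of_cyclotomicCharacter_eq_one` — `I ∩ ker χ_p ⊆ ker a`;
* **`exists_continuousMonoidHom_factor`** — (T2-ii): for `a : Γ_{ℚ_p} →ₜ* Multiplicative ℤ_[p]`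
  there is `f : ℤ_[p]ˣ →ₜ* Multiplicative ℤ_[p]` with `a σ = f (χ_p σ)` for all `σ ∈ I` — the
  shape consumed BY NAME by K3's assembly (x11b3-p1).

This is Serre, *Local Fields* XIV §7 Thm. 2 (`ℚ_p^ab = ℚ_p^nr · ℚ_p(μ_{p^∞})`, i.e.
`I(ℚ̄_p/ℚ_p^ab) = I_{ℚ_p} ∩ ker χ_p`) read for `ℤ_p`-valued instead of finite-valued characters.

References: J.-P. Serre, *Local Fields*, GTM 67 (1979), Ch. XIV §7 Thm. 2 [`SerreLocalFields1979`];
L. C. Washington, *Introduction to Cyclotomic Fields*, GTM 83, Thm. 14.2 [`Washington1997`]. Cell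
files: `cells/x11b3/OWNERS.md` R9-25 / R9-27, `HOME/b2b-bsdres-x11b3-p1/gen3/K3-INVENTORY.md` §(T2).
-/

noncomputable section

open scoped NumberField
open ValuativeRel Field IsDedekindDomain
open Literature.NumberTheory.GaloisRepresentations

namespace Summit.BirchSwinnertonDyer.Rank1Residual.X11b.PadicInertiaCharacter

variable (p : ℕ) [Fact p.Prime]

/-! ### §4. The `ℤ_p`-valued limit form -/

section Continuous

variable [IsNonarchimedeanLocalField ℚ_[p]]

/-- **The level-`m` reduction of a continuous additive `a : Γ_{ℚ_p} → ℤ_p` is locally constant in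
`χ_p` on inertia**: for every `m` there is `k ≥ 1` such that for `σ, σ' ∈ I_{ℚ_p}`,
`χ_p(σ) ≡ χ_p(σ') (mod p^k)` implies `a(σ) ≡ a(σ') (mod p^m)`.  (Apply
`exists_eq_comp_cyclotomicCharacter_of_mem_absInertia` to `a mod p^m : Γ_{ℚ_p} → ℤ/p^m`, a
homomorphism to a discrete commutative group whose kernel `a⁻¹(p^m ℤ_p)` is open by continuity.)
Ref: Serre, *Local Fields*, XIV §7 Thm. 2. [cite: SerreLocalFields1979, Ch. XIV §7 Thm. 2] -/
theorem toZModPow_apply_eq_of_toZModPow_cyclotomicCharacter_eq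
    (a : absoluteGaloisGroup ℚ_[p] → ℤ_[p])
    (hmul : ∀ σ τ, a (σ * τ) = a σ + a τ) (hcont : Continuous a) (m : ℕ) :
    ∃ k : ℕ, 0 < k ∧ ∀ σ ∈ absInertia ℚ_[p], ∀ σ' ∈ absInertia ℚ_[p],
      ((GaloisRep.cyclotomicCharacter ℚ_[p] p σ : ℤ_[p]ˣ) : ℤ_[p]).toZModPow k =
        ((GaloisRep.cyclotomicCharacter ℚ_[p] p σ' : ℤ_[p]ˣ) : ℤ_[p]).toZModPow k →
      (a σ).toZModPow m = (a σ').toZModPow m := by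
  have ha1 : a 1 = 0 := by
    have h := hmul 1 1
    rw [mul_one] at h
    simpa using h
  -- the level-`m` reduction as a homomorphism to `Multiplicative (ZMod (p^m))`
  let Λ : absoluteGaloisGroup ℚ_[p] →* Multiplicative (ZMod (p ^ m)) :=
    { toFun := fun σ => Multiplicative.ofAdd ((a σ).toZModPow m)
      map_one' := by simp [ha1]
      map_mul' := fun σ τ => by
        rw [hmul, map_add, ofAdd_add] }
  have hΛ : ∀ σ, Λ σ = Multiplicative.ofAdd ((a σ).toZModPow m) := fun _ => rfl
  have hker : ((Λ.ker : Subgroup (absoluteGaloisGroup ℚ_[p])) : Set (absoluteGaloisGroup ℚ_[p])) =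
      a ⁻¹' Metric.closedBall (0 : ℤ_[p]) ((p : ℝ) ^ (-(m : ℤ))) := by
    ext σ
    rw [SetLike.mem_coe, MonoidHom.mem_ker, hΛ, ← ofAdd_zero, Multiplicative.ofAdd.injective.eq_iff,
      Set.mem_preimage, Metric.mem_closedBall, dist_zero_right,
      PadicInt.norm_le_pow_iff_mem_span_pow, ← PadicInt.ker_toZModPow, RingHom.mem_ker]
  have hopen : IsOpen ((Λ.ker : Subgroup (absoluteGaloisGroup ℚ_[p])) :
      Set (absoluteGaloisGroup ℚ_[p])) := by
    rw [hker]
    refine IsOpen.preimage hcont (IsUltrametricDist.isOpen_closedBall _ ?_)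
    exact (zpow_pos (by exact_mod_cast (Fact.out : p.Prime).pos) _).ne'
  obtain ⟨k, hk, g, hg⟩ := exists_eq_comp_cyclotomicCharacter_of_mem_absInertia p Λ hopen
    (fun x y => mul_comm _ _)
  refine ⟨k, hk, fun σ hσ σ' hσ' hχ => ?_⟩
  have h1 := hg σ hσ
  have h2 := hg σ' hσ'
  have hu : Units.map (PadicInt.toZModPow k).toMonoidHom (GaloisRep.cyclotomicCharacter ℚ_[p] p σ) =
      Units.map (PadicInt.toZModPow k).toMonoidHom (GaloisRep.cyclotomicCharacter ℚ_[p] p σ') :=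
    Units.ext hχ
  rw [hu, ← h2, hΛ, hΛ] at h1
  exact Multiplicative.ofAdd.injective h1

/-- **A continuous additive `a : Γ_{ℚ_p} → ℤ_p` factors through `χ_p` on inertia**: there is a
continuous additive `f : ℤ_pˣ → ℤ_p` (`f (u v) = f u + f v`) with `a(σ) = f(χ_p(σ))` for all
`σ ∈ I_{ℚ_p}`.  (`χ_p(σ) = χ_p(σ')` forces `a(σ) = a(σ')` on `I` at every level `p^m`
(`toZModPow_apply_eq_of_toZModPow_cyclotomicCharacter_eq`), so `f := a ∘ s` for any section `s` of
`χ_p|_I` (`exists_mem_absInertia_cyclotomicCharacter_eq`) works; `f` is continuous because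
`f mod p^m` is constant on the cosets of `1 + p^{k_m} ℤ_p`.)  This is Serre XIV §7 Thm. 2 for
`ℤ_p`-valued (rather than finite-valued) characters: `I(ℚ̄_p/ℚ_p^ab) = I_{ℚ_p} ∩ ker χ_p`.
[cite: SerreLocalFields1979, Ch. XIV §7 Thm. 2] -/
theorem exists_continuous_factor
    (a : absoluteGaloisGroup ℚ_[p] → ℤ_[p])
    (hmul : ∀ σ τ, a (σ * τ) = a σ + a τ) (hcont : Continuous a) :
    ∃ f : ℤ_[p]ˣ → ℤ_[p], Continuous f ∧ (∀ u v, f (u * v) = f u + f v) ∧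
      ∀ σ ∈ absInertia ℚ_[p], a σ = f (GaloisRep.cyclotomicCharacter ℚ_[p] p σ) := by
  classical
  set χ := GaloisRep.cyclotomicCharacter ℚ_[p] p with hχ_def
  -- on inertia, `a` only depends on `χ`
  have hKC : ∀ σ ∈ absInertia ℚ_[p], ∀ σ' ∈ absInertia ℚ_[p], χ σ = χ σ' → a σ = a σ' := by
    intro σ hσ σ' hσ' h
    refine PadicInt.ext_of_toZModPow.mp fun m => ?_
    obtain ⟨k, -, hk⟩ := toZModPow_apply_eq_of_toZModPow_cyclotomicCharacter_eq p a hmul hcont m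
    exact hk σ hσ σ' hσ' (by rw [h])
  -- a section of `χ` on inertia
  have hsec := fun u : ℤ_[p]ˣ => exists_mem_absInertia_cyclotomicCharacter_eq p u
  choose s hsI hsχ using hsec
  refine ⟨fun u => a (s u), ?_, fun u v => ?_, fun σ hσ => ?_⟩
  · -- continuity: `f mod p^m` is constant on `u · (1 + p^k ℤ_p)`
    refine continuous_iff_continuousAt.mpr fun u => ?_
    refine Metric.tendsto_nhds.mpr fun ε hε => ?_
    obtain ⟨m, hm⟩ := PadicInt.exists_pow_neg_lt p hε
    obtain ⟨k, -, hk⟩ := toZModPow_apply_eq_of_toZModPow_cyclotomicCharacter_eq p a hmul hcont m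
    have hkpos : (0 : ℝ) < (p : ℝ) ^ (-(k : ℤ)) :=
      zpow_pos (by exact_mod_cast (Fact.out : p.Prime).pos) _
    have hN : (Units.val ⁻¹' Metric.ball (u : ℤ_[p]) ((p : ℝ) ^ (-(k : ℤ))) : Set ℤ_[p]ˣ) ∈
        nhds u :=
      (Metric.isOpen_ball.preimage Units.continuous_val).mem_nhds (Metric.mem_ball_self hkpos)
    refine Filter.mem_of_superset hN fun u' hu' => ?_
    rw [Set.mem_preimage, Metric.mem_ball, dist_eq_norm] at hu'
    change dist (a (s u')) (a (s u)) < ε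
    rw [dist_eq_norm]
    have hred : ((u' : ℤ_[p]ˣ) : ℤ_[p]).toZModPow k = ((u : ℤ_[p]ˣ) : ℤ_[p]).toZModPow k := by
      rw [← sub_eq_zero, ← map_sub, ← RingHom.mem_ker, PadicInt.ker_toZModPow,
        ← PadicInt.norm_le_pow_iff_mem_span_pow]
      exact hu'.le
    have hm' := hk (s u') (hsI u') (s u) (hsI u) (by rw [hsχ, hsχ]; exact hred)
    have hle : ‖a (s u') - a (s u)‖ ≤ (p : ℝ) ^ (-(m : ℤ)) := by
      rw [PadicInt.norm_le_pow_iff_mem_span_pow, ← PadicInt.ker_toZModPow, RingHom.mem_ker, map_sub,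
        sub_eq_zero]
      exact hm'
    exact hle.trans_lt hm
  · -- additivity
    change a (s (u * v)) = a (s u) + a (s v)
    rw [← hmul]
    exact hKC _ (hsI _) _ ((absInertia ℚ_[p]).mul_mem (hsI u) (hsI v))
      (by rw [map_mul, hsχ, hsχ, hsχ])
  · -- factorisation on inertia
    change a σ = a (s (χ σ))
    exact hKC σ hσ _ (hsI _) (by rw [hsχ])

/-- **`I ∩ ker χ_p ⊆ ker a`** for a continuous additive `a : Γ_{ℚ_p} → ℤ_p`: an inertia element
with trivial cyclotomic character is killed by `a` (`exists_continuous_factor` with `f(1) = 0`) —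
Serre XIV §7 Thm. 2, `I(ℚ̄_p/ℚ_p^ab) = I_{ℚ_p} ∩ ker χ_p`, for `ℤ_p`-valued characters.
[cite: SerreLocalFields1979, Ch. XIV §7 Thm. 2] -/
theorem apply_eq_zero_of_mem_absInertia_of_cyclotomicCharacter_eq_one
    (a : absoluteGaloisGroup ℚ_[p] → ℤ_[p])
    (hmul : ∀ σ τ, a (σ * τ) = a σ + a τ) (hcont : Continuous a)
    {σ : absoluteGaloisGroup ℚ_[p]} (hσ : σ ∈ absInertia ℚ_[p])
    (hχ : GaloisRep.cyclotomicCharacter ℚ_[p] p σ = 1) : a σ = 0 := by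
  obtain ⟨f, -, hfmul, hf⟩ := exists_continuous_factor p a hmul hcont
  have hf1 : f 1 = 0 := by
    have h := hfmul 1 1
    rw [mul_one] at h
    simpa using h
  rw [hf σ hσ, hχ, hf1]

/-- **(T2-ii), the shape consumed by K3's assembly.**  Every continuous homomorphism
`a : Γ_{ℚ_p} →ₜ* ℤ_p` (written multiplicatively, `Multiplicative ℤ_[p]`) agrees on the inertia
group `I_{ℚ_p}` with `f ∘ χ_p` for a continuous homomorphism `f : ℤ_pˣ →ₜ* ℤ_p`
(`exists_continuous_factor` repackaged).  Serre, *Local Fields* XIV §7 Thm. 2 (`ℚ_p^ab =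
ℚ_p^nr · ℚ_p(μ_{p^∞})`) for `ℤ_p`-valued characters.
[cite: SerreLocalFields1979, Ch. XIV §7 Thm. 2] -/
theorem exists_continuousMonoidHom_factor
    (a : absoluteGaloisGroup ℚ_[p] →ₜ* Multiplicative ℤ_[p]) :
    ∃ f : ℤ_[p]ˣ →ₜ* Multiplicative ℤ_[p], ∀ σ ∈ absInertia ℚ_[p],
      a σ = f (GaloisRep.cyclotomicCharacter ℚ_[p] p σ) := by
  obtain ⟨f, hfc, hfmul, hf⟩ := exists_continuous_factor p (fun σ => (a σ).toAdd)
    (fun σ τ => by rw [map_mul, toAdd_mul]) (continuous_toAdd.comp a.continuous)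
  have hf1 : f 1 = 0 := by
    have h := hfmul 1 1
    rw [mul_one] at h
    simpa using h
  let F : ℤ_[p]ˣ →ₜ* Multiplicative ℤ_[p] :=
    { toFun := fun u => Multiplicative.ofAdd (f u)
      map_one' := by simp only [hf1, ofAdd_zero]
      map_mul' := fun u v => by simp only [hfmul, ofAdd_add]
      continuous_toFun := continuous_ofAdd.comp hfc }
  refine ⟨F, fun σ hσ => ?_⟩
  change a σ = Multiplicative.ofAdd (f (GaloisRep.cyclotomicCharacter ℚ_[p] p σ))
  rw [← hf σ hσ, ofAdd_toAdd]

end Continuous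

end Summit.BirchSwinnertonDyer.Rank1Residual.X11b.PadicInertiaCharacter
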